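import Mathlib
import Summits.ValiantsHypothesis.ValiantsHypothesis.Theorems.NewtonUnitEquationsTwoProductsRankOneFourLawPlanar
import HarnessLib

/-!
# `TwoProducts` (stmt-ValiantsHypothesis-5906), line `relation_ladder` — NEGATIVE lane: the EXCESS LAWS of a rank-one datum
# (family-free kernel form of the principles «excess transport», «modulus», «rigidity» and a support-pattern escape criterion)

Helper file of the Negative lane (val-neg-1 g4; `--supports stmt-ValiantsHypothesis-5906`; closes NO item).  The shape-by-shape escape
files (`…Negative.RankTwoEscapes`, `…TwoSidedShapeEscapes`, `…UnitTwoThreeEscapes`, `…RankOneDatumRigidity`) each verify, for ONE planted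
relation shape, that certain rung data cannot serve it.  This file isolates the datum-level laws behind all of them, with no family and
no shape in the hypotheses, so that a rung SCHEMA quantified over the datum `(ρ⁺, ρ⁻)` can cite them directly.

For a `k`-shift `P + k•ρ⁺ = Q + k•ρ⁻` between letter multisets `P, Q : Expo →₀ ℕ` and a datum `(ρ⁺, ρ⁻)` write `P ∸ Q`, `Q ∸ P` for the
truncated differences (the two EXCESS vectors of the coincidence) and `ρ⁻ ∸ ρ⁺`, `ρ⁺ ∸ ρ⁻` for those of the datum.

* `excess_eq_nsmul_of_shift` (MODULUS LAW): `P ∸ Q = k • (ρ⁻ ∸ ρ⁺)` and `Q ∸ P = k • (ρ⁺ ∸ ρ⁻)`.  Corollaries: the excess supports of the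
  coincidence sit inside those of the datum (`support_excess_subset_of_shift`, EXCESS TRANSPORT, with the card form
  `card_excess_le_of_shift`); `k` divides every excess (`dvd_excess_of_shift`); an excess of modulus one forces `k = 1` and then the
  excess vectors of coincidence and datum COINCIDE (`k_eq_one_of_excess_one`, `excess_eq_of_excess_one`, RIGIDITY).
* `shift_reduce` / `rankOne_reduce`: the common part of a datum is irrelevant — `(ρ⁺, ρ⁻)` may be replaced by the disjoint pair
  `(ρ⁺ ∸ ρ⁻, ρ⁻ ∸ ρ⁺)`; for a disjoint datum a non-trivial `k`-shift pins the datum's SUPPORTS to the coincidence's excess supports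
  (`support_eq_of_shift_disjoint`) and the datum itself to the excess pair divided by `k` (`nsmul_datum_eq_excess_of_disjoint`, with
  converse `shift_of_excess_eq` and the dictionary `rankOne_iff_excess_multiples`: rank one with a disjoint datum = «every realised
  excess pair is a multiple of the datum pair, up to the swap»).
* `rankOne_proportional`, `rankOne_support_pattern`, `no_datum_of_two_patterns` (ESCAPE CRITERION): any two non-permutation
  coincidences of a rank-one family have PROPORTIONAL excess pairs `c•(Pa ∸ Qb, Qb ∸ Pa) = d•(Pa' ∸ Qb', Qb' ∸ Pa')` up to the swap; in particular every
  non-permutation coincidence has the same unordered pair of excess supports `{supp ρ⁺', supp ρ⁻'}` (`ρ'` the reduced datum); hence a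
  family exhibiting two non-permutation coincidences with different unordered excess-support pairs fits NO rank-one datum whatsoever.

Honest framing: helper lemmas only; `TwoProducts` (5906), the residual LAW `ResidualLawV20` and VP ≠ VNP are NOT proved here and are not
claimed. [folklore]
-/

namespace Summit.ValiantsHypothesis.Theorems.TwoProducts.Negative.DatumExcess

open Finset
open Summit.ValiantsHypothesis.ValiantsHypothesis.Theorems.NewtonUnitEquations.TwoProducts.FormalLogLinearisation (Expo)
open Summit.ValiantsHypothesis.ValiantsHypothesis.Theorems.NewtonUnitEquations.TwoProducts.PlanarCell (tuples)
open Summit.ValiantsHypothesis.ValiantsHypothesis.Theorems.NewtonUnitEquations.TwoProducts.PermutationType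
  (msetT RankOneCoincidences)

variable {m : ℕ}

/-! ### The modulus law and its corollaries (one orientation; the other is the same lemma with `P, Q` swapped) -/

/-- Pointwise form of a `k`-shift. [folklore] -/
theorem shift_apply {P Q ρp ρm : Expo →₀ ℕ} {k : ℕ} (h : P + k • ρp = Q + k • ρm) (e : Expo) :
    P e + k * ρp e = Q e + k * ρm e := by
  have := DFunLike.congr_fun h e
  simpa only [Finsupp.add_apply, Finsupp.smul_apply, smul_eq_mul] using this

/-- **Modulus law.**  Under a `k`-shift the excess vectors of the coincidence are `k` times those of the datum. [folklore] -/
theorem excess_eq_nsmul_of_shift {P Q ρp ρm : Expo →₀ ℕ} {k : ℕ} (h : P + k • ρp = Q + k • ρm) :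
    P - Q = k • (ρm - ρp) ∧ Q - P = k • (ρp - ρm) := by
  refine ⟨Finsupp.ext fun e => ?_, Finsupp.ext fun e => ?_⟩ <;>
  · have := shift_apply h e
    simp only [Finsupp.tsub_apply, Finsupp.smul_apply, smul_eq_mul, mul_tsub]
    omega

/-- **Excess transport.**  The strict-excess letters of the coincidence are strict-excess letters of the datum, side by side. [folklore] -/
theorem support_excess_subset_of_shift {P Q ρp ρm : Expo →₀ ℕ} {k : ℕ} (h : P + k • ρp = Q + k • ρm) :
    (P - Q).support ⊆ (ρm - ρp).support ∧ (Q - P).support ⊆ (ρp - ρm).support := by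
  obtain ⟨h₁, h₂⟩ := excess_eq_nsmul_of_shift h
  exact ⟨h₁ ▸ Finsupp.support_smul, h₂ ▸ Finsupp.support_smul⟩

/-- Card form of excess transport: a datum with `s⁻ = #supp(ρ⁻ ∸ ρ⁺)`, `s⁺ = #supp(ρ⁺ ∸ ρ⁻)` serves (in this orientation) only
coincidences with at most `s⁻` letters of `P`-excess and at most `s⁺` letters of `Q`-excess. [folklore] -/
theorem card_excess_le_of_shift {P Q ρp ρm : Expo →₀ ℕ} {k : ℕ} (h : P + k • ρp = Q + k • ρm) :
    #(P - Q).support ≤ #(ρm - ρp).support ∧ #(Q - P).support ≤ #(ρp - ρm).support :=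
  ⟨card_le_card (support_excess_subset_of_shift h).1, card_le_card (support_excess_subset_of_shift h).2⟩

/-- `k` divides every excess of the coincidence. [folklore] -/
theorem dvd_excess_of_shift {P Q ρp ρm : Expo →₀ ℕ} {k : ℕ} (h : P + k • ρp = Q + k • ρm) (e : Expo) :
    k ∣ (P - Q) e ∧ k ∣ (Q - P) e := by
  obtain ⟨h₁, h₂⟩ := excess_eq_nsmul_of_shift h
  refine ⟨Dvd.intro ((ρm - ρp) e) ?_, Dvd.intro ((ρp - ρm) e) ?_⟩
  · rw [h₁, Finsupp.smul_apply, smul_eq_mul]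
  · rw [h₂, Finsupp.smul_apply, smul_eq_mul]

/-- **Rigidity, step 1.**  An excess of modulus one (on either side) forces `k = 1`. [folklore] -/
theorem k_eq_one_of_excess_one {P Q ρp ρm : Expo →₀ ℕ} {k : ℕ} (h : P + k • ρp = Q + k • ρm) {e₀ : Expo}
    (he : (P - Q) e₀ = 1 ∨ (Q - P) e₀ = 1) : k = 1 := by
  obtain ⟨h₁, h₂⟩ := excess_eq_nsmul_of_shift h
  rcases he with he | he
  · rw [h₁, Finsupp.smul_apply, smul_eq_mul] at he
    exact Nat.eq_one_of_mul_eq_one_right he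
  · rw [h₂, Finsupp.smul_apply, smul_eq_mul] at he
    exact Nat.eq_one_of_mul_eq_one_right he

/-- **Rigidity, step 2.**  With an excess of modulus one, the excess vectors of coincidence and datum coincide. [folklore] -/
theorem excess_eq_of_excess_one {P Q ρp ρm : Expo →₀ ℕ} {k : ℕ} (h : P + k • ρp = Q + k • ρm) {e₀ : Expo}
    (he : (P - Q) e₀ = 1 ∨ (Q - P) e₀ = 1) : P - Q = ρm - ρp ∧ Q - P = ρp - ρm := by
  have hk := k_eq_one_of_excess_one h he
  subst hk
  simpa using excess_eq_nsmul_of_shift h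

/-! ### Reduction to disjoint data -/

/-- The common part of a datum cancels: a `k`-shift for `(ρ⁺, ρ⁻)` is a `k`-shift for the disjoint pair `(ρ⁺ ∸ ρ⁻, ρ⁻ ∸ ρ⁺)`. [folklore] -/
theorem shift_reduce {P Q ρp ρm : Expo →₀ ℕ} {k : ℕ} (h : P + k • ρp = Q + k • ρm) :
    P + k • (ρp - ρm) = Q + k • (ρm - ρp) := by
  refine Finsupp.ext fun e => ?_
  have := shift_apply h e
  simp only [Finsupp.add_apply, Finsupp.smul_apply, smul_eq_mul, Finsupp.tsub_apply, mul_tsub]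
  omega

/-- The reduced pair is disjoint. [folklore] -/
theorem reduce_disjoint (ρp ρm : Expo →₀ ℕ) (e : Expo) : (ρp - ρm) e = 0 ∨ (ρm - ρp) e = 0 := by
  simp only [Finsupp.tsub_apply]
  omega

/-- **Every rank-one datum may be taken disjoint.** [folklore] -/
theorem rankOne_reduce {A : Fin m → Finset Expo} {ρp ρm : Expo →₀ ℕ} (h : RankOneCoincidences A ρp ρm) :
    RankOneCoincidences A (ρp - ρm) (ρm - ρp) := by
  intro a ha b hb hab
  obtain ⟨k, hk⟩ := h a ha b hb hab
  exact ⟨k, hk.imp shift_reduce shift_reduce⟩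

/-- For a disjoint datum the truncated differences are the datum itself. [folklore] -/
theorem tsub_eq_self_of_disjoint {ρp ρm : Expo →₀ ℕ} (hdis : ∀ e, ρp e = 0 ∨ ρm e = 0) :
    ρm - ρp = ρm ∧ ρp - ρm = ρp := by
  refine ⟨Finsupp.ext fun e => ?_, Finsupp.ext fun e => ?_⟩ <;>
  · simp only [Finsupp.tsub_apply]
    rcases hdis e with h0 | h0 <;> omega

/-- **A disjoint datum is the excess pair divided by `k`**: `k • ρ⁻ = P ∸ Q` and `k • ρ⁺ = Q ∸ P`. [folklore] -/
theorem nsmul_datum_eq_excess_of_disjoint {P Q ρp ρm : Expo →₀ ℕ} {k : ℕ} (h : P + k • ρp = Q + k • ρm)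
    (hdis : ∀ e, ρp e = 0 ∨ ρm e = 0) : k • ρm = P - Q ∧ k • ρp = Q - P := by
  obtain ⟨h₁, h₂⟩ := excess_eq_nsmul_of_shift h
  obtain ⟨hm, hp⟩ := tsub_eq_self_of_disjoint hdis
  rw [hm] at h₁; rw [hp] at h₂
  exact ⟨h₁.symm, h₂.symm⟩

/-- With an excess of modulus one a disjoint datum IS the excess pair: `(ρ⁺, ρ⁻) = (Q ∸ P, P ∸ Q)`. [folklore] -/
theorem datum_eq_excess_of_disjoint {P Q ρp ρm : Expo →₀ ℕ} {k : ℕ} (h : P + k • ρp = Q + k • ρm)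
    (hdis : ∀ e, ρp e = 0 ∨ ρm e = 0) {e₀ : Expo} (he : (P - Q) e₀ = 1 ∨ (Q - P) e₀ = 1) :
    ρp = Q - P ∧ ρm = P - Q := by
  have hk := k_eq_one_of_excess_one h he
  subst hk
  have := nsmul_datum_eq_excess_of_disjoint h hdis
  simp only [one_smul] at this
  exact ⟨this.2, this.1⟩

/-- A non-trivial shift has `k ≠ 0`. [folklore] -/
theorem k_ne_zero_of_shift {P Q ρp ρm : Expo →₀ ℕ} {k : ℕ} (h : P + k • ρp = Q + k • ρm) (hPQ : P ≠ Q) : k ≠ 0 := by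
  rintro rfl
  simp at h
  exact hPQ h

/-- **Support pinning.**  A non-trivial `k`-shift of a disjoint datum pins the datum's supports to the excess supports of the
coincidence: `supp(P ∸ Q) = supp ρ⁻`, `supp(Q ∸ P) = supp ρ⁺`. [folklore] -/
theorem support_eq_of_shift_disjoint {P Q ρp ρm : Expo →₀ ℕ} {k : ℕ} (h : P + k • ρp = Q + k • ρm)
    (hdis : ∀ e, ρp e = 0 ∨ ρm e = 0) (hPQ : P ≠ Q) :
    (P - Q).support = ρm.support ∧ (Q - P).support = ρp.support := by
  have hk := k_ne_zero_of_shift h hPQ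
  obtain ⟨h₁, h₂⟩ := nsmul_datum_eq_excess_of_disjoint h hdis
  refine ⟨?_, ?_⟩
  · rw [← h₁]; ext e; simp [Finsupp.mem_support_iff, hk]
  · rw [← h₂]; ext e; simp [Finsupp.mem_support_iff, hk]

/-- Converse of `nsmul_datum_eq_excess_of_disjoint`: prescribing the excess pair gives the shift (no disjointness needed). [folklore] -/
theorem shift_of_excess_eq {P Q ρp ρm : Expo →₀ ℕ} {k : ℕ} (h₁ : k • ρm = P - Q) (h₂ : k • ρp = Q - P) :
    P + k • ρp = Q + k • ρm := by
  refine Finsupp.ext fun e => ?_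
  have e₁ := DFunLike.congr_fun h₁ e
  have e₂ := DFunLike.congr_fun h₂ e
  simp only [Finsupp.smul_apply, smul_eq_mul, Finsupp.tsub_apply] at e₁ e₂
  simp only [Finsupp.add_apply, Finsupp.smul_apply, smul_eq_mul]
  omega

/-- **Dictionary.**  For a disjoint datum, `RankOneCoincidences A ρ⁺ ρ⁻` says exactly: the excess pair `(Pa ∸ Qb, Qb ∸ Pa)` of every
coincidence is `k • (ρ⁻, ρ⁺)` or `k • (ρ⁺, ρ⁻)` for some `k` (`k = 0` iff the coincidence is a permutation one). [folklore] -/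
theorem rankOne_iff_excess_multiples {A : Fin m → Finset Expo} {ρp ρm : Expo →₀ ℕ} (hdis : ∀ e, ρp e = 0 ∨ ρm e = 0) :
    RankOneCoincidences A ρp ρm ↔
      ∀ a ∈ tuples A, ∀ b ∈ tuples A, ∑ j, a j = ∑ j, b j →
        ∃ k : ℕ, (k • ρm = msetT a - msetT b ∧ k • ρp = msetT b - msetT a) ∨
          (k • ρm = msetT b - msetT a ∧ k • ρp = msetT a - msetT b) := by
  refine ⟨fun h a ha b hb hab => ?_, fun h a ha b hb hab => ?_⟩
  · obtain ⟨k, hk | hk⟩ := h a ha b hb hab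
    · exact ⟨k, Or.inl (nsmul_datum_eq_excess_of_disjoint hk hdis)⟩
    · exact ⟨k, Or.inr (nsmul_datum_eq_excess_of_disjoint hk hdis)⟩
  · obtain ⟨k, ⟨h₁, h₂⟩ | ⟨h₁, h₂⟩⟩ := h a ha b hb hab
    · exact ⟨k, Or.inl (shift_of_excess_eq h₁ h₂)⟩
    · exact ⟨k, Or.inr (shift_of_excess_eq h₁ h₂)⟩

/-! ### Family level: the support pattern of a rank-one family, and the two-pattern escape criterion -/

/-- **Support pattern.**  In a family all of whose coincidences are `k`-shifts of a DISJOINT datum `(ρ⁺, ρ⁻)`, every non-permutation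
coincidence `msetT a ≠ msetT b` has the unordered pair of excess supports `{supp ρ⁻, supp ρ⁺}`. [folklore] -/
theorem rankOne_support_pattern {A : Fin m → Finset Expo} {ρp ρm : Expo →₀ ℕ} (h : RankOneCoincidences A ρp ρm)
    (hdis : ∀ e, ρp e = 0 ∨ ρm e = 0) {a b : Fin m → Expo} (ha : a ∈ tuples A) (hb : b ∈ tuples A)
    (hab : ∑ j, a j = ∑ j, b j) (hne : msetT a ≠ msetT b) :
    ((msetT a - msetT b).support = ρm.support ∧ (msetT b - msetT a).support = ρp.support) ∨
      ((msetT a - msetT b).support = ρp.support ∧ (msetT b - msetT a).support = ρm.support) := by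
  obtain ⟨k, hk | hk⟩ := h a ha b hb hab
  · exact Or.inl (support_eq_of_shift_disjoint hk hdis hne)
  · have := support_eq_of_shift_disjoint hk hdis (Ne.symm hne)
    exact Or.inr ⟨this.2, this.1⟩

/-- **Proportionality.**  In a rank-one family any two non-permutation coincidences have PROPORTIONAL excess pairs (up to the swap):
`c • (Pa ∸ Qb, Qb ∸ Pa) = d • (Pa' ∸ Qb', Qb' ∸ Pa')` or `= d • (Qb' ∸ Pa', Pa' ∸ Qb')` with `c, d ≠ 0`. [folklore] -/
theorem rankOne_proportional {A : Fin m → Finset Expo} {ρp ρm : Expo →₀ ℕ} (h : RankOneCoincidences A ρp ρm)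
    {a b a' b' : Fin m → Expo}
    (ha : a ∈ tuples A) (hb : b ∈ tuples A) (hab : ∑ j, a j = ∑ j, b j) (hne : msetT a ≠ msetT b)
    (ha' : a' ∈ tuples A) (hb' : b' ∈ tuples A) (hab' : ∑ j, a' j = ∑ j, b' j) (hne' : msetT a' ≠ msetT b') :
    ∃ c d : ℕ, c ≠ 0 ∧ d ≠ 0 ∧
      ((c • (msetT a - msetT b) = d • (msetT a' - msetT b') ∧ c • (msetT b - msetT a) = d • (msetT b' - msetT a')) ∨
        (c • (msetT a - msetT b) = d • (msetT b' - msetT a') ∧ c • (msetT b - msetT a) = d • (msetT a' - msetT b'))) := by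
  have hr := rankOne_reduce h
  have hdis := reduce_disjoint ρp ρm
  have key : ∀ {P Q P' Q' : Expo →₀ ℕ} {k k' : ℕ}, P + k • (ρp - ρm) = Q + k • (ρm - ρp) → P ≠ Q →
      P' + k' • (ρp - ρm) = Q' + k' • (ρm - ρp) → P' ≠ Q' →
      k' ≠ 0 ∧ k ≠ 0 ∧ k' • (P - Q) = k • (P' - Q') ∧ k' • (Q - P) = k • (Q' - P') := by
    intro P Q P' Q' k k' hk hPQ hk' hPQ'
    obtain ⟨h₁, h₂⟩ := nsmul_datum_eq_excess_of_disjoint hk hdis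
    obtain ⟨h₃, h₄⟩ := nsmul_datum_eq_excess_of_disjoint hk' hdis
    refine ⟨k_ne_zero_of_shift hk' hPQ', k_ne_zero_of_shift hk hPQ, ?_, ?_⟩
    · rw [← h₁, ← h₃, smul_smul, smul_smul, mul_comm]
    · rw [← h₂, ← h₄, smul_smul, smul_smul, mul_comm]
  obtain ⟨k, hk | hk⟩ := hr a ha b hb hab <;> obtain ⟨k', hk' | hk'⟩ := hr a' ha' b' hb' hab'
  · obtain ⟨h0', h0, e₁, e₂⟩ := key hk hne hk' hne'
    exact ⟨k', k, h0', h0, Or.inl ⟨e₁, e₂⟩⟩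
  · obtain ⟨h0', h0, e₁, e₂⟩ := key hk hne hk' (Ne.symm hne')
    exact ⟨k', k, h0', h0, Or.inr ⟨e₁, e₂⟩⟩
  · obtain ⟨h0', h0, e₁, e₂⟩ := key hk (Ne.symm hne) hk' hne'
    exact ⟨k', k, h0', h0, Or.inr ⟨e₂, e₁⟩⟩
  · obtain ⟨h0', h0, e₁, e₂⟩ := key hk (Ne.symm hne) hk' (Ne.symm hne')
    exact ⟨k', k, h0', h0, Or.inl ⟨e₂, e₁⟩⟩

/-- **Two-pattern escape criterion.**  A family exhibiting two non-permutation coincidences whose unordered pairs of excess supports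
differ fits NO rank-one datum `(ρ⁺, ρ⁻)` at all (disjoint or not). [folklore] -/
theorem no_datum_of_two_patterns {A : Fin m → Finset Expo} {a b a' b' : Fin m → Expo}
    (ha : a ∈ tuples A) (hb : b ∈ tuples A) (hab : ∑ j, a j = ∑ j, b j) (hne : msetT a ≠ msetT b)
    (ha' : a' ∈ tuples A) (hb' : b' ∈ tuples A) (hab' : ∑ j, a' j = ∑ j, b' j) (hne' : msetT a' ≠ msetT b')
    (hpat : ¬ (((msetT a - msetT b).support = (msetT a' - msetT b').support ∧
                (msetT b - msetT a).support = (msetT b' - msetT a').support) ∨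
              ((msetT a - msetT b).support = (msetT b' - msetT a').support ∧
                (msetT b - msetT a).support = (msetT a' - msetT b').support))) :
    ¬ ∃ ρp ρm : Expo →₀ ℕ, RankOneCoincidences A ρp ρm := by
  rintro ⟨ρp, ρm, h⟩
  have hr := rankOne_reduce h
  have hdis := reduce_disjoint ρp ρm
  rcases rankOne_support_pattern hr hdis ha hb hab hne with ⟨h₁, h₂⟩ | ⟨h₁, h₂⟩ <;>
    rcases rankOne_support_pattern hr hdis ha' hb' hab' hne' with ⟨h₃, h₄⟩ | ⟨h₃, h₄⟩
  · exact hpat (Or.inl ⟨h₁.trans h₃.symm, h₂.trans h₄.symm⟩)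
  · exact hpat (Or.inr ⟨h₁.trans h₄.symm, h₂.trans h₃.symm⟩)
  · exact hpat (Or.inr ⟨h₁.trans h₄.symm, h₂.trans h₃.symm⟩)
  · exact hpat (Or.inl ⟨h₁.trans h₃.symm, h₂.trans h₄.symm⟩)

end Summit.ValiantsHypothesis.Theorems.TwoProducts.Negative.DatumExcess
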